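import Mathlib.MeasureTheory.Constructions.Pi
import Mathlib.MeasureTheory.Group.LIntegral
import Mathlib.MeasureTheory.Group.Integral
import Mathlib.MeasureTheory.Integral.Prod
import HarnessLib

/-!
# Venture YMGap — track (c) «DS», Lean brick B2: GAUGE FREEZING (disintegration of a left-invariant
# density on `G^{n+1}` along one coordinate)

HONEST FRAMING: venture file (cell `pub-ymgap`, PLAN R95 brick B2 of the kernel row for the star
door); a GENERIC measure-theoretic identity on a measurable group with a left-invariant probability
measure — nothing specific to lattice gauge theory is asserted here, and nothing about the continuum
or the mass gap.

**The identity.**  Let `μ` be a left-invariant probability measure on a measurable group `G`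
(Haar on a compact group), `n : ℕ`, and let `Ψ : (Fin (n+1) → G) → ℝ≥0∞` (or a bounded real `Ψ`) be
measurable and invariant under the SIMULTANEOUS left translation of all coordinates,
`Ψ (fun i => g * x i) = Ψ x`.  Then

  `∫ Ψ dμ^{⊗(n+1)} = ∫ Ψ (1 ∷ η) dμ^{⊗n}(η)`

— the coordinate `0` may be FROZEN to `1` (`lintegral_pi_eq_lintegral_cons_one`,
`integral_pi_eq_integral_cons_one`).  Proof: split `G^{n+1} ≅ G × G^n`
(`measurePreserving_piFinSuccAbove` at `0`, whose inverse is `Fin.cons`), Tonelli/Fubini, translate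
the inner `G^n`-integral by the constant vector `a` (left invariance of the product measure,
`Measure.pi.isMulLeftInvariant`), use `a ∷ (a·η) = a · (1 ∷ η)` and the invariance of `Ψ`; the outer
integral of a constant over a probability space is the constant.

**Use (cell, Lemma G of GAUGE-STAR.md / STAR-PROOF.md P10).**  The star window kernel of lattice
gauge theory at a vertex is `ρ · Haar^{⊗8}` with `ρ` invariant under the centre gauge action (left
multiplication of the 8 star links); for a gauge-invariant observable `F`, applying the identity to
`Ψ = F·ρ` and to `Ψ = ρ` shows that expectations (hence covariances) under the star kernel equal those
under the 7-link law with the link `a` frozen to `1` — the «gauge-fixed» law `ν^{(a)}` of Lemma G.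
That instantiation (brick B4) is NOT done in this file.

References: standard (Weil's formula / disintegration of Haar measure along a quotient); H. Föllmer,
LNM 1362 (1988) Ch. I for the use in Dobrushin comparison; cell files GAUGE-STAR.md §2(D),
STAR-PROOF.md P10.
-/

noncomputable section

open MeasureTheory
open scoped ENNReal

namespace Summit.Ventures.YMGap.StarDisintegration

variable {G : Type*} [Group G] [MeasurableSpace G] [MeasurableMul₂ G]
variable (μ : Measure G) [IsProbabilityMeasure μ] [μ.IsMulLeftInvariant]

omit [Group G] [MeasurableMul₂ G] in
/-- The inverse of Mathlib's `piFinSuccAbove` at the coordinate `0` is `Fin.cons`. [folklore] -/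
theorem piFinSuccAbove_zero_symm_apply {n : ℕ} (p : G × (Fin n → G)) :
    (MeasurableEquiv.piFinSuccAbove (fun _ : Fin (n + 1) => G) 0).symm p = Fin.cons p.1 p.2 := by
  simp [MeasurableEquiv.piFinSuccAbove_symm_apply, Fin.insertNthEquiv, Fin.insertNth_zero']

omit [MeasurableSpace G] [MeasurableMul₂ G] in
/-- `a ∷ (a·η) = a · (1 ∷ η)` coordinatewise. [folklore] -/
theorem cons_mul_eq_mul_cons_one {n : ℕ} (a : G) (η : Fin n → G) :
    (Fin.cons a (fun j => a * η j) : Fin (n + 1) → G) =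
      fun i => a * (Fin.cons (1 : G) η : Fin (n + 1) → G) i := by
  funext i
  refine Fin.cases ?_ (fun j => ?_) i
  · simp
  · simp

/-- **Gauge freezing, `ℝ≥0∞` version.**  For a left-invariant probability measure `μ` on `G` and a
measurable `Ψ ≥ 0` on `G^{n+1}` invariant under simultaneous left translation of all coordinates,
`∫⁻ Ψ dμ^{⊗(n+1)} = ∫⁻ Ψ(1 ∷ η) dμ^{⊗n}(η)`. [folklore] -/
theorem lintegral_pi_eq_lintegral_cons_one {n : ℕ} {Ψ : (Fin (n + 1) → G) → ℝ≥0∞}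
    (hΨm : Measurable Ψ) (hΨ : ∀ (g : G) (x : Fin (n + 1) → G), Ψ (fun i => g * x i) = Ψ x) :
    ∫⁻ x, Ψ x ∂(Measure.pi fun _ : Fin (n + 1) => μ) =
      ∫⁻ η, Ψ (Fin.cons 1 η) ∂(Measure.pi fun _ : Fin n => μ) := by
  set e := MeasurableEquiv.piFinSuccAbove (fun _ : Fin (n + 1) => G) 0 with he
  have hmp : MeasurePreserving e (Measure.pi fun _ : Fin (n + 1) => μ)
      (μ.prod (Measure.pi fun _ : Fin n => μ)) :=
    measurePreserving_piFinSuccAbove (fun _ : Fin (n + 1) => μ) 0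
  -- move to the product `G × G^n`
  have h1 : ∫⁻ x, Ψ x ∂(Measure.pi fun _ : Fin (n + 1) => μ) =
      ∫⁻ p, Ψ (e.symm p) ∂(μ.prod (Measure.pi fun _ : Fin n => μ)) :=
    ((hmp.symm e).lintegral_comp hΨm).symm
  rw [h1]
  have hF : Measurable fun p : G × (Fin n → G) => Ψ (e.symm p) := hΨm.comp e.symm.measurable
  rw [lintegral_prod _ hF.aemeasurable]
  -- the inner integral does not depend on the first coordinate
  have hinner : ∀ a : G, ∫⁻ η, Ψ (e.symm (a, η)) ∂(Measure.pi fun _ : Fin n => μ) =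
      ∫⁻ η, Ψ (Fin.cons 1 η) ∂(Measure.pi fun _ : Fin n => μ) := by
    intro a
    have hcons : ∀ η : Fin n → G, Ψ (e.symm (a, η)) = Ψ (Fin.cons a η) := fun η => by
      rw [he, piFinSuccAbove_zero_symm_apply]
    simp_rw [hcons]
    -- translate the `G^n`-integral by the constant vector `a`
    have htr := lintegral_mul_left_eq_self (μ := Measure.pi fun _ : Fin n => μ)
      (fun η => Ψ (Fin.cons a η)) (fun _ => a)
    rw [← htr]
    refine lintegral_congr fun η => ?_
    have hprod : ((fun _ : Fin n => a) * η) = fun j => a * η j := rfl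
    rw [hprod, cons_mul_eq_mul_cons_one, hΨ]
  simp_rw [hinner]
  rw [lintegral_const, measure_univ, mul_one]

/-- **Gauge freezing, real version** for bounded measurable invariant `Ψ`:
`∫ Ψ dμ^{⊗(n+1)} = ∫ Ψ(1 ∷ η) dμ^{⊗n}(η)`. [folklore] -/
theorem integral_pi_eq_integral_cons_one {n : ℕ} {Ψ : (Fin (n + 1) → G) → ℝ}
    (hΨm : Measurable Ψ) {B : ℝ} (hB : ∀ x, |Ψ x| ≤ B)
    (hΨ : ∀ (g : G) (x : Fin (n + 1) → G), Ψ (fun i => g * x i) = Ψ x) :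
    ∫ x, Ψ x ∂(Measure.pi fun _ : Fin (n + 1) => μ) =
      ∫ η, Ψ (Fin.cons 1 η) ∂(Measure.pi fun _ : Fin n => μ) := by
  set e := MeasurableEquiv.piFinSuccAbove (fun _ : Fin (n + 1) => G) 0 with he
  have hmp : MeasurePreserving e (Measure.pi fun _ : Fin (n + 1) => μ)
      (μ.prod (Measure.pi fun _ : Fin n => μ)) :=
    measurePreserving_piFinSuccAbove (fun _ : Fin (n + 1) => μ) 0
  have h1 : ∫ x, Ψ x ∂(Measure.pi fun _ : Fin (n + 1) => μ) =
      ∫ p, Ψ (e.symm p) ∂(μ.prod (Measure.pi fun _ : Fin n => μ)) :=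
    ((hmp.symm e).integral_comp e.symm.measurableEmbedding Ψ).symm
  rw [h1]
  have hFm : Measurable fun p : G × (Fin n → G) => Ψ (e.symm p) := hΨm.comp e.symm.measurable
  have hFi : Integrable (fun p : G × (Fin n → G) => Ψ (e.symm p))
      (μ.prod (Measure.pi fun _ : Fin n => μ)) := by
    refine Integrable.mono' (integrable_const B) hFm.aestronglyMeasurable ?_
    exact Filter.Eventually.of_forall fun p => by
      rw [Real.norm_eq_abs]; exact hB _
  rw [integral_prod _ hFi]
  have hinner : ∀ a : G, ∫ η, Ψ (e.symm (a, η)) ∂(Measure.pi fun _ : Fin n => μ) =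
      ∫ η, Ψ (Fin.cons 1 η) ∂(Measure.pi fun _ : Fin n => μ) := by
    intro a
    have hcons : ∀ η : Fin n → G, Ψ (e.symm (a, η)) = Ψ (Fin.cons a η) := fun η => by
      rw [he, piFinSuccAbove_zero_symm_apply]
    simp_rw [hcons]
    have htr := integral_mul_left_eq_self (μ := Measure.pi fun _ : Fin n => μ)
      (fun η => Ψ (Fin.cons a η)) (fun _ => a)
    rw [← htr]
    refine integral_congr_ae (Filter.Eventually.of_forall fun η => ?_)
    have hprod : ((fun _ : Fin n => a) * η) = fun j => a * η j := rfl
    simp only []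
    rw [hprod, cons_mul_eq_mul_cons_one, hΨ]
  simp_rw [hinner]
  rw [integral_const]
  simp

end Summit.Ventures.YMGap.StarDisintegration

end
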